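import Summits.QuantumAdvantage.QuantumAdvantage.Theorems.CubicForrelationNearExactIsExactBentShiftOnS
import Summits.QuantumAdvantage.QuantumAdvantage.Theorems.CubicForrelationNearExactIsExactBentLadderTwentyTwo

/-!
# Crux `CubicForrelation.NearExactIsExact` (stmt-QuantumAdvantage-14043) — `n = 22`: a cubic BENT function has no cubic partner at `Φ = 125/128`

Certificate seat `b2b-cforr-cert` (gen 44).  HONEST FRAMING: a kernel-checked finite-slice THEOREM (standard axioms): the `n = 22` twin of
…BentFourteenTwentyNineThirtySeconds — the Kasami–Tokura line `|S| = 49152 = 1.5·2¹⁵` of THEOREM BENT22 (DISPROOF.md §18.4, there by machine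
certificates): for cubic `f, g : 𝔽₂²² → 𝔽₂` with `g` bent, `Φ(f,g) ≠ 125/128` (a value INSIDE the open window `θ₂₂ ∈ [15/16, 127/128)`).  Same
argument with `m = 11`, `r = 7`, `s = 5` prefix factors, classes of `8192` points and plateau height `16384 > 2¹¹`: `kh_structure` (order 7),
`kb_ladder_four_twentytwo`, `kb_fibre_structure`, `kb_shift_on_S`, `kb_bent_gap_bound`.  NOT summit progress; `θ₂₂`'s window is unchanged (the
other bent-side lines at `n = 22`, in particular the weight-`2d` line `Φ = 31/32` (the BQ-11 value), are NOT treated here).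

References: T. Kasami, N. Tokura (1970) Thm 1; O. S. Rothaus (1976); X.-D. Hou (1998); DISPROOF.md §18.4.  Axioms: the standard three.
-/

set_option linter.dupNamespace false -- D-0017: single-problem summit ⇒ `QuantumAdvantage.QuantumAdvantage` by design

noncomputable section

namespace Summit.QuantumAdvantage.QuantumAdvantage.Theorems.CubicForrelation.NearExactIsExact

open Finset
open Literature.Computability.QuantumComplexity
open Literature.Computability.QuantumComplexity.BuzetChailloux (bxor zeroVec bxor_self bxor_zeroVec zeroVec_bxor bxor_comm
  bxor_bxor_cancel_left signOf_sq)
open Literature.Computability.QuantumComplexity.DerivativeWalsh (W twist_bxor_left sum_W_sq)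
open Literature.Computability.QuantumComplexity.Simon (twist_eq_one_or)

variable {n : ℕ}

/-! ### The theorem -/

/-- **A cubic bent function on 22 bits has no cubic partner at `Φ = 125/128`.**  For cubic `f, g : 𝔽₂²² → 𝔽₂` with `g` bent (`W_g² ≡ 2²²`),
`Φ(f,g) ≠ 125/128`.  Finite-slice statement; NOT summit progress. [this work] -/
theorem fo22_bent_ne_125_128 (f g : (Fin (11 + 11) → Bool) → Bool) (hf : IsDegLeFun 3 f) (hg : IsDegLeFun 3 g)
    (hbent : ∀ x, W (fun y => signOf (g y)) x ^ 2 = (2 : ℝ) ^ (11 + 11)) (hΦ : forrelation f g = 125 / 128) : False := by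
  classical
  -- the dual and its degree
  obtain ⟨d, hd⟩ := bb_exists_dual hbent
  have hdeg : IsDegLeFun (6 + 1) d := stub_houCubic stub_axParity 11 g d hg hd
  -- `#S = 49152`
  have hsum := vg_two_pow_mul_forrelation f g
  rw [hΦ, sum_congr rfl fun x _ => by rw [hd x]] at hsum
  have hsd : ∑ x, signOf (f x) * signOf (d x) = 4096000 := by
    have e : ∑ x, signOf (f x) * ((2 : ℝ) ^ 11 * signOf (d x)) = 2 ^ 11 * ∑ x, signOf (f x) * signOf (d x) := by
      rw [mul_sum]; exact sum_congr rfl fun x _ => by ring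
    have c : (2 : ℝ) ^ (3 * 11) * (125 / 128) = 2 ^ 11 * 4096000 := by norm_num
    rw [e, c] at hsum
    exact (mul_left_cancel₀ (by norm_num) hsum).symm
  rw [bb_sum_signOf_mul_signOf, ← bb_filter_bxor_eq] at hsd
  set S := univ.filter (fun x : Fin (11 + 11) → Bool => (f x ^^ d x) = true) with hSdef
  have hcard : #S = 49152 := by
    have c : (2 : ℝ) ^ (11 + 11) = 4194304 := by norm_num
    rw [c] at hsd
    have h : (#S : ℝ) = 49152 := by linarith
    exact_mod_cast h
  -- Kasami–Tokura normal form of `f ⊕ d`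
  have he : IsDegLeFun (5 + 2) (fun x => f x ^^ d x) := bb_isDegLeFun_bxor (hf.mono (by norm_num)) hdeg
  obtain ⟨A, P, v, u, x₀, hA, hP, hAv, hAv', -, hPv, hPu, hPu', hx₀, hnf⟩ :=
    kh_structure 5 (11 + 11) (fun x => f x ^^ d x) he (by rw [hcard]; norm_num)
  have hnf' : ∀ x, (f x ^^ d x) = (((A 0 x && A 1 x) ^^ (A 2 x && A 3 x)) && decide (∀ j, P j x = true)) := fun x => hnf x
  obtain ⟨w₀, hw₀P, h0, h1, h2, h3⟩ := kh_pattern A P v hAv hAv' hPv x₀ hx₀ false false false false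
  have hw₀A : ∀ i, A i w₀ = false := by
    intro i
    fin_cases i
    · exact h0
    · exact h1
    · exact h2
    · exact h3
  -- ladder ⇒ fibre structure ⇒ constant shifts along `W'` on `S`
  obtain ⟨α₀, α₁, α₂, α₃, γ, hγ, hfib⟩ := kb_fibre_structure f A P v hAv hAv' hPv w₀ hw₀P hw₀A
    (fun q hq a ha => kb_ladder_four_twentytwo f g d hf hg hd A P u hPu hPu' hnf' q hq a ha)
  have hshift := kb_shift_on_S f d A P v hA hP hAv hAv' hPv hnf' w₀ hw₀P hw₀A α₀ α₁ α₂ α₃ γ hγ hfib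
  have hmemS : ∀ x, x ∈ S ↔ (f x ^^ d x) = true := fun x => by rw [hSdef, mem_filter]; simp
  -- the classes `{P = 1, A = b}`
  have hclass : ∀ x, (f x ^^ d x) = true → (∀ j, P j x = true) ∧ ((A 0 x && A 1 x) ^^ (A 2 x && A 3 x)) = true := by
    intro x hx
    rw [hnf' x, Bool.and_eq_true] at hx
    exact ⟨of_decide_eq_true hx.2, hx.1⟩
  -- a translation fixing `A`, `P` at one point fixes them everywhere
  have fixOf : ∀ x x' : Fin (11 + 11) → Bool, (∀ i, A i x' = A i x) → (∀ j, P j x' = P j x) →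
      (∀ i z, A i (bxor z (bxor x x')) = A i z) ∧ (∀ j z, P j (bxor z (bxor x x')) = P j z) := by
    intro x x' hAx hPx
    have e : bxor x (bxor x x') = x' := bxor_bxor_cancel_left x x'
    refine ⟨fun i z => ?_, fun j z => ?_⟩
    · obtain ⟨ε, hε⟩ := kh_affine_shift (A i) (hA i) (bxor x x')
      have h := hε x
      rw [e, hAx i] at h
      have : ε = false := by revert h; cases A i x <;> cases ε <;> simp
      rw [hε, this, Bool.xor_false]
    · obtain ⟨ε, hε⟩ := kh_affine_shift (P j) (hP j) (bxor x x')
      have h := hε x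
      rw [e, hPx j] at h
      have : ε = false := by revert h; cases P j x <;> cases ε <;> simp
      rw [hε, this, Bool.xor_false]
  -- class sizes: all `#{P = 1, A = b}` are equal, hence `= 8192` on the six `Q = 1` patterns
  set N : Bool → Bool → Bool → Bool → ℕ := fun b0 b1 b2 b3 =>
    #(univ.filter fun x : Fin (11 + 11) → Bool => (∀ j, P j x = true) ∧ A 0 x = b0 ∧ A 1 x = b1 ∧ A 2 x = b2 ∧ A 3 x = b3) with hN
  have r01 : ∀ x, A 0 (bxor x (v 1)) = A 0 x := fun x => hAv' 0 1 x (by decide)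
  have r02 : ∀ x, A 0 (bxor x (v 2)) = A 0 x := fun x => hAv' 0 2 x (by decide)
  have r03 : ∀ x, A 0 (bxor x (v 3)) = A 0 x := fun x => hAv' 0 3 x (by decide)
  have r10 : ∀ x, A 1 (bxor x (v 0)) = A 1 x := fun x => hAv' 1 0 x (by decide)
  have r12 : ∀ x, A 1 (bxor x (v 2)) = A 1 x := fun x => hAv' 1 2 x (by decide)
  have r13 : ∀ x, A 1 (bxor x (v 3)) = A 1 x := fun x => hAv' 1 3 x (by decide)
  have r20 : ∀ x, A 2 (bxor x (v 0)) = A 2 x := fun x => hAv' 2 0 x (by decide)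
  have r21 : ∀ x, A 2 (bxor x (v 1)) = A 2 x := fun x => hAv' 2 1 x (by decide)
  have r23 : ∀ x, A 2 (bxor x (v 3)) = A 2 x := fun x => hAv' 2 3 x (by decide)
  have r30 : ∀ x, A 3 (bxor x (v 0)) = A 3 x := fun x => hAv' 3 0 x (by decide)
  have r31 : ∀ x, A 3 (bxor x (v 1)) = A 3 x := fun x => hAv' 3 1 x (by decide)
  have r32 : ∀ x, A 3 (bxor x (v 2)) = A 3 x := fun x => hAv' 3 2 x (by decide)
  have flip0 : ∀ b0 b1 b2 b3, N b0 b1 b2 b3 = N (!b0) b1 b2 b3 := by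
    intro b0 b1 b2 b3
    simp only [hN]
    rw [← kh_card_translate (fun x => (∀ j, P j x = true) ∧ A 0 x = b0 ∧ A 1 x = b1 ∧ A 2 x = b2 ∧ A 3 x = b3) (v 0)]
    congr 1; ext x
    simp only [mem_filter, mem_univ, true_and, hPv, hAv 0, r10, r20, r30]
    cases A 0 x <;> cases b0 <;> simp
  have flip1 : ∀ b0 b1 b2 b3, N b0 b1 b2 b3 = N b0 (!b1) b2 b3 := by
    intro b0 b1 b2 b3
    simp only [hN]
    rw [← kh_card_translate (fun x => (∀ j, P j x = true) ∧ A 0 x = b0 ∧ A 1 x = b1 ∧ A 2 x = b2 ∧ A 3 x = b3) (v 1)]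
    congr 1; ext x
    simp only [mem_filter, mem_univ, true_and, hPv, hAv 1, r01, r21, r31]
    cases A 1 x <;> cases b1 <;> simp
  have flip2 : ∀ b0 b1 b2 b3, N b0 b1 b2 b3 = N b0 b1 (!b2) b3 := by
    intro b0 b1 b2 b3
    simp only [hN]
    rw [← kh_card_translate (fun x => (∀ j, P j x = true) ∧ A 0 x = b0 ∧ A 1 x = b1 ∧ A 2 x = b2 ∧ A 3 x = b3) (v 2)]
    congr 1; ext x
    simp only [mem_filter, mem_univ, true_and, hPv, hAv 2, r02, r12, r32]
    cases A 2 x <;> cases b2 <;> simp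
  have flip3 : ∀ b0 b1 b2 b3, N b0 b1 b2 b3 = N b0 b1 b2 (!b3) := by
    intro b0 b1 b2 b3
    simp only [hN]
    rw [← kh_card_translate (fun x => (∀ j, P j x = true) ∧ A 0 x = b0 ∧ A 1 x = b1 ∧ A 2 x = b2 ∧ A 3 x = b3) (v 3)]
    congr 1; ext x
    simp only [mem_filter, mem_univ, true_and, hPv, hAv 3, r03, r13, r23]
    cases A 3 x <;> cases b3 <;> simp
  have hallN : ∀ b0 b1 b2 b3, N b0 b1 b2 b3 = N false false false false := by
    intro b0 b1 b2 b3
    cases b0 <;> cases b1 <;> cases b2 <;> cases b3 <;>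
      simp only [flip0 true, flip1 _ true, flip2 _ _ true, flip3 _ _ _ true, Bool.not_true]
  -- the pattern map and the six admissible patterns
  set τ : (Fin (11 + 11) → Bool) → Bool × Bool × Bool × Bool := fun x => (A 0 x, A 1 x, A 2 x, A 3 x) with hτ
  set T : Finset (Bool × Bool × Bool × Bool) :=
    {(true, true, false, false), (true, true, true, false), (true, true, false, true),
     (false, false, true, true), (true, false, true, true), (false, true, true, true)} with hT
  have hQT : ∀ b0 b1 b2 b3 : Bool, ((b0 && b1) ^^ (b2 && b3)) = true → (b0, b1, b2, b3) ∈ T := by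
    rw [hT]; decide
  have hmaps : ∀ x ∈ S, τ x ∈ T := fun x hx => hQT _ _ _ _ (hclass x ((hmemS x).1 hx)).2
  have hfibre : ∀ b0 b1 b2 b3 : Bool, (b0, b1, b2, b3) ∈ T →
      S.filter (fun x => τ x = (b0, b1, b2, b3)) =
        univ.filter (fun x : Fin (11 + 11) → Bool => (∀ j, P j x = true) ∧ A 0 x = b0 ∧ A 1 x = b1 ∧ A 2 x = b2 ∧ A 3 x = b3) := by
    intro b0 b1 b2 b3 hb
    have hQb : ((b0 && b1) ^^ (b2 && b3)) = true := by
      revert hb; rw [hT]; revert b0 b1 b2 b3; decide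
    ext x
    simp only [hSdef, hτ, mem_filter, mem_univ, true_and, Prod.mk.injEq, hnf', Bool.and_eq_true, decide_eq_true_eq]
    constructor
    · rintro ⟨⟨-, hPx⟩, e0, e1, e2, e3⟩; exact ⟨hPx, e0, e1, e2, e3⟩
    · rintro ⟨hPx, e0, e1, e2, e3⟩; refine ⟨⟨?_, hPx⟩, e0, e1, e2, e3⟩; rw [e0, e1, e2, e3]; exact hQb
  have hN128 : N false false false false = 8192 := by
    have h := card_eq_sum_card_fiberwise (f := τ) (s := S) (t := T) (fun x hx => hmaps x hx)
    rw [hcard, hT] at h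
    rw [sum_insert (by decide), sum_insert (by decide), sum_insert (by decide), sum_insert (by decide), sum_insert (by decide),
      sum_singleton] at h
    rw [hfibre _ _ _ _ (by rw [hT]; decide), hfibre _ _ _ _ (by rw [hT]; decide), hfibre _ _ _ _ (by rw [hT]; decide),
      hfibre _ _ _ _ (by rw [hT]; decide), hfibre _ _ _ _ (by rw [hT]; decide), hfibre _ _ _ _ (by rw [hT]; decide)] at h
    have e1 := hallN true true false false
    have e2 := hallN true true true false
    have e3 := hallN true true false true
    have e4 := hallN false false true true
    have e5 := hallN true false true true
    have e6 := hallN false true true true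
    simp only [hN] at e1 e2 e3 e4 e5 e6 ⊢
    omega
  -- the plateau of the partial transform
  have hplateau : ∀ y, ∑ x ∈ S, signOf (d x) * twist x y = 0 ∨ (16384 : ℝ) ≤ |∑ x ∈ S, signOf (d x) * twist x y| := by
    intro y
    set ψ : (Fin (11 + 11) → Bool) → ℝ := fun t => signOf (γ (bxor w₀ t) ^^ γ w₀) * twist t y with hψ
    have hφ : ∀ t, (∀ i z, A i (bxor z t) = A i z) → (∀ j z, P j (bxor z t) = P j z) → ∀ x, x ∈ S →
        signOf (d (bxor x t)) * twist (bxor x t) y = ψ t * (signOf (d x) * twist x y) := by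
      intro t htA htP x hx
      have hxS := (hmemS x).1 hx
      have hxtS : (f (bxor x t) ^^ d (bxor x t)) = true := by
        rw [hnf'] at hxS ⊢; simp only [htA, htP]; exact hxS
      have hft := hshift t htA htP x hxS
      have hdx : d (bxor x t) = (d x ^^ (γ (bxor w₀ t) ^^ γ w₀)) := by
        revert hxS hxtS; rw [hft]
        cases f x <;> cases d x <;> cases d (bxor x t) <;> cases (γ (bxor w₀ t) ^^ γ w₀) <;> decide
      rw [hdx, signOf_xor, twist_bxor_left]
      simp only [hψ]; ring
    have hSinv : ∀ t, (∀ i z, A i (bxor z t) = A i z) → (∀ j z, P j (bxor z t) = P j z) → ∀ x, x ∈ S → bxor x t ∈ S := by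
      intro t htA htP x hx
      rw [hmemS] at hx ⊢
      rw [hnf'] at hx ⊢; simp only [htA, htP]; exact hx
    have hDψ : ∀ t, (∀ i z, A i (bxor z t) = A i z) → (∀ j z, P j (bxor z t) = P j z) →
        ∑ x ∈ S, signOf (d x) * twist x y = ψ t * ∑ x ∈ S, signOf (d x) * twist x y := by
      intro t htA htP
      rw [mul_sum]
      calc ∑ x ∈ S, signOf (d x) * twist x y = ∑ x ∈ S, signOf (d (bxor x t)) * twist (bxor x t) y := by
            refine (sum_nbij' (fun x => bxor x t) (fun x => bxor x t) (fun x hx => hSinv t htA htP x hx)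
              (fun x hx => hSinv t htA htP x hx) (fun x _ => by simp [iw_bxor_assoc]) (fun x _ => by simp [iw_bxor_assoc])
              (fun x _ => rfl)).symm
        _ = ∑ x ∈ S, ψ t * (signOf (d x) * twist x y) := sum_congr rfl fun x hx => hφ t htA htP x hx
    have hψ1 : ∀ t, ψ t = 1 ∨ ψ t = -1 := by
      intro t; simp only [hψ]
      rcases twist_eq_one_or t y with h | h <;> cases (γ (bxor w₀ t) ^^ γ w₀) <;> simp [signOf, h]
    by_cases hneg : ∃ t, (∀ i z, A i (bxor z t) = A i z) ∧ (∀ j z, P j (bxor z t) = P j z) ∧ ψ t = -1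
    · obtain ⟨t, htA, htP, hm⟩ := hneg
      left
      have h := hDψ t htA htP
      rw [hm] at h
      linarith
    · push Not at hneg
      have hone : ∀ t, (∀ i z, A i (bxor z t) = A i z) → (∀ j z, P j (bxor z t) = P j z) → ψ t = 1 := by
        intro t htA htP
        rcases hψ1 t with h | h
        · exact h
        · exact absurd h (hneg t htA htP)
      -- on each class the summand is constant
      have hconst : ∀ x x', x ∈ S → (∀ i, A i x' = A i x) → (∀ j, P j x' = P j x) →
          signOf (d x') * twist x' y = signOf (d x) * twist x y := by
        intro x x' hx hAx hPx
        obtain ⟨htA, htP⟩ := fixOf x x' hAx hPx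
        have h := hφ (bxor x x') htA htP x hx
        rw [bxor_bxor_cancel_left, hone _ htA htP, one_mul] at h
        exact h
      -- decompose the sum over the six classes
      have hdec := (sum_fiberwise_of_maps_to (s := S) (t := T) (g := τ) hmaps (fun x => signOf (d x) * twist x y)).symm
      have hcl : ∀ b0 b1 b2 b3 : Bool, (b0, b1, b2, b3) ∈ T → ∃ ε : ℝ, (ε = 1 ∨ ε = -1) ∧
          ∑ x ∈ S.filter (fun x => τ x = (b0, b1, b2, b3)), signOf (d x) * twist x y = 8192 * ε := by
        intro b0 b1 b2 b3 hb
        have hQb : ((b0 && b1) ^^ (b2 && b3)) = true := by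
          revert hb; rw [hT]; revert b0 b1 b2 b3; decide
        rw [hfibre _ _ _ _ hb]
        have hcardC : #(univ.filter fun x : Fin (11 + 11) → Bool =>
            (∀ j, P j x = true) ∧ A 0 x = b0 ∧ A 1 x = b1 ∧ A 2 x = b2 ∧ A 3 x = b3) = 8192 := by
          have := hallN b0 b1 b2 b3; simp only [hN] at this; rw [this]; simpa only [hN] using hN128
        obtain ⟨x₁, hx₁⟩ := card_pos.1 (by rw [hcardC]; norm_num)
        have hx₁' := (mem_filter.1 hx₁).2
        have hx₁S : x₁ ∈ S := by
          rw [hmemS, hnf', hx₁'.2.1, hx₁'.2.2.1, hx₁'.2.2.2.1, hx₁'.2.2.2.2, decide_eq_true hx₁'.1, Bool.and_true]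
          exact hQb
        refine ⟨signOf (d x₁) * twist x₁ y, ?_, ?_⟩
        · rcases twist_eq_one_or x₁ y with h | h <;> cases d x₁ <;> simp [signOf, h]
        · rw [sum_congr rfl fun x hx => hconst x₁ x hx₁S
            (fun i => by
              have hx' := (mem_filter.1 hx).2
              fin_cases i
              · exact hx'.2.1.trans hx₁'.2.1.symm
              · exact hx'.2.2.1.trans hx₁'.2.2.1.symm
              · exact hx'.2.2.2.1.trans hx₁'.2.2.2.1.symm
              · exact hx'.2.2.2.2.trans hx₁'.2.2.2.2.symm)
            (fun j => by rw [((mem_filter.1 hx).2).1 j, hx₁'.1 j]),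
            sum_const, hcardC, nsmul_eq_mul]
          norm_num
      rw [hdec, hT, sum_insert (by decide), sum_insert (by decide), sum_insert (by decide), sum_insert (by decide),
        sum_insert (by decide), sum_singleton]
      obtain ⟨ε₁, hε₁, e₁⟩ := hcl true true false false (by rw [hT]; decide)
      obtain ⟨ε₂, hε₂, e₂⟩ := hcl true true true false (by rw [hT]; decide)
      obtain ⟨ε₃, hε₃, e₃⟩ := hcl true true false true (by rw [hT]; decide)
      obtain ⟨ε₄, hε₄, e₄⟩ := hcl false false true true (by rw [hT]; decide)
      obtain ⟨ε₅, hε₅, e₅⟩ := hcl true false true true (by rw [hT]; decide)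
      obtain ⟨ε₆, hε₆, e₆⟩ := hcl false true true true (by rw [hT]; decide)
      rw [e₁, e₂, e₃, e₄, e₅, e₆]
      rcases hε₁ with h₁ | h₁ <;> rcases hε₂ with h₂ | h₂ <;> rcases hε₃ with h₃ | h₃ <;> rcases hε₄ with h₄ | h₄ <;>
        rcases hε₅ with h₅ | h₅ <;> rcases hε₆ with h₆ | h₆ <;> rw [h₁, h₂, h₃, h₄, h₅, h₆] <;> norm_num
  -- Parseval and the contradiction
  have hgap := kb_bent_gap_bound g d hd S 16384 (by norm_num) hplateau
  have hpar : ∑ y, (∑ x ∈ S, signOf (d x) * twist x y) ^ 2 = (2 : ℝ) ^ (11 + 11) * #S := by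
    set F : (Fin (11 + 11) → Bool) → ℝ := fun x => if x ∈ S then signOf (d x) else 0 with hF
    have hW : ∀ y, W F y = ∑ x ∈ S, signOf (d x) * twist x y := by
      intro y
      rw [W]
      simp only [hF, ite_mul, zero_mul]
      rw [sum_ite_mem, univ_inter]
    have hF2 : ∀ x, F x ^ 2 = if x ∈ S then 1 else 0 := by
      intro x
      by_cases hx : x ∈ S
      · simp only [hF, if_pos hx, signOf_sq]
      · simp only [hF, if_neg hx]; norm_num
    rw [sum_congr rfl fun y _ => by rw [← hW y], sum_W_sq, sum_congr rfl fun x _ => hF2 x, sum_boole]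
    simp
  rw [hpar, hcard] at hgap
  norm_num at hgap

end Summit.QuantumAdvantage.QuantumAdvantage.Theorems.CubicForrelation.NearExactIsExact

end
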